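import Mathlib.Analysis.Complex.RemovableSingularity
import Mathlib.Analysis.Complex.Liouville
import Mathlib.Analysis.Analytic.IsolatedZeros
import Mathlib.Analysis.SpecialFunctions.Complex.Analytic
import Mathlib.RingTheory.RootsOfUnity.Complex
import HarnessLib

/-!
# Eigenfunctions of a rotation of finite order vanish to the order of their weight; decay kills entire functions

Layer `Literature/Analysis/Complex` (one complex variable). Four elementary facts of function
theory, recorded for the holomorphic `2`-forms of the Fermat surface
(`AlgebraicGeometry/HodgeTheory/FermatSurfaceEigenformsOnModels`: the `χ_β`-eigenforms are read
along curves invariant under the cyclic coordinate rotations `s ↦ ζ s`, `ζᵐ = 1`):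

* `isBigO_pow_of_rotation_eigen` — **an eigenfunction of the rotation `s ↦ ζ s` of weight `c`
  vanishes to order `≥ c` at the centre**: if `φ` is holomorphic near `0`, `ζ` is a primitive
  `m`-th root of unity, `c < m` and `φ(ζ s) = ζᶜ φ(s)` near `0`, then `φ(s) = O(sᶜ)` — the Taylor
  coefficients `a_k` with `k ≢ c (mod m)` vanish (here: the order of vanishing `k` has
  `ζᵏ = ζᶜ`, so `k ≡ c`, so `k ≥ c`); Forster, *Riemann Surfaces*, §8 (local normal form of a
  holomorphic map commuting with the deck rotation of `z ↦ zᵐ`);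
* `eq_zero_of_differentiable_of_tendsto_cocompact` — **an entire function tending to `0` at
  infinity is zero** (Liouville);
* `exists_differentiable_eqOn_of_bddAbove` — **finitely many bounded singularities are
  removable at once** (Riemann's theorem on removable singularities,
  `Complex.differentiableOn_update_limUnder_of_bddAbove`, applied point by point);
* `exists_analyticAt_pow_eq` — **a holomorphic `m`-th root**: for `c₀ᵐ = B ≠ 0` there is `c`
  analytic at `0` with `c 0 = c₀`, `c(s)ᵐ = A sᵐ + B` for all `s` and `c(u s) = c(s)` whenever
  `uᵐ = 1` (`c = c₀ (1 + A sᵐ/B)^{1/m}`, principal branch).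

Everything is proved (theorems only; no definitions, no named facts — D-0026).

## References

* O. Forster, *Lectures on Riemann Surfaces*, GTM 81 (1981), §8 (Thm. 8.4: proper holomorphic
  coverings and `z ↦ zᵏ`), §1 Thm. 1.8 (removable singularities). [Forster1981]
* W. Rudin, *Real and Complex Analysis*, 3rd ed. (1987), Thm. 10.20 (removable singularities),
  Thm. 10.23 (Liouville). [Rudin1987]
-/

noncomputable section

open scoped Topology
open Set Filter Metric Complex Asymptotics Function

namespace Literature.Analysis.Complex

/-! ### Eigenfunctions of a finite-order rotation -/

/-- A function continuous at `0` which vanishes on a punctured neighbourhood of `0` vanishes at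
`0`. [folklore] -/
theorem apply_zero_eq_zero_of_eventuallyEq_punctured {G : ℂ → ℂ} (hG : ContinuousAt G 0)
    (h0 : ∀ᶠ s in 𝓝[≠] (0 : ℂ), G s = 0) : G 0 = 0 := by
  have h1 : Tendsto G (𝓝[≠] (0 : ℂ)) (𝓝 (G 0)) := hG.tendsto.mono_left nhdsWithin_le_nhds
  have h2 : Tendsto G (𝓝[≠] (0 : ℂ)) (𝓝 0) :=
    (tendsto_const_nhds (x := (0 : ℂ))).congr' (h0.mono fun s hs ↦ hs.symm)
  exact tendsto_nhds_unique h1 h2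

/-- **An eigenfunction of weight `c` of the rotation `s ↦ ζ s` (`ζ` a primitive `m`-th root of
unity, `c < m`) vanishes to order at least `c` at `0`.** If `φ` is complex differentiable on a
neighbourhood of `0` and `φ(ζ s) = ζᶜ φ(s)` for `s` near `0`, then `φ(s) = O(sᶜ)` as `s → 0`.
Proof: either `φ ≡ 0` near `0`, or `φ(s) = sᵏ g(s)` with `g(0) ≠ 0`
(`AnalyticAt.exists_eventuallyEq_pow_smul_nonzero_iff`); comparing `φ(ζ s)` computed both ways
gives `ζᵏ g(ζ s) = ζᶜ g(s)` for `s ≠ 0`, hence `ζᵏ = ζᶜ` at `s = 0`, `k ≡ c (mod m)` and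
`k ≥ c`. In print: the power series of `φ` only involves `sᵏ` with `k ≡ c (mod m)`.
[cite: Forster1981, §8 Thm. 8.4 (proof: local form of maps commuting with the deck rotation)] -/
theorem isBigO_pow_of_rotation_eigen {φ : ℂ → ℂ} {U : Set ℂ} (hU : U ∈ 𝓝 (0 : ℂ))
    (hφ : DifferentiableOn ℂ φ U) {m c : ℕ} {ζ : ℂ} (hζ : IsPrimitiveRoot ζ m) (hcm : c < m)
    (heig : ∀ᶠ s in 𝓝 (0 : ℂ), φ (ζ * s) = ζ ^ c * φ s) :
    φ =O[𝓝 0] fun s ↦ s ^ c := by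
  have hm : m ≠ 0 := by omega
  have han : AnalyticAt ℂ φ 0 := hφ.analyticAt hU
  by_cases hzero : ∀ᶠ s in 𝓝 (0 : ℂ), φ s = 0
  · exact (isBigO_zero (fun s : ℂ ↦ s ^ c) (𝓝 (0 : ℂ))).congr' (hzero.mono fun s hs ↦ hs.symm)
      EventuallyEq.rfl
  obtain ⟨k, g, hg, hg0, hφg⟩ := han.exists_eventuallyEq_pow_smul_nonzero_iff.2 hzero
  simp only [sub_zero, smul_eq_mul] at hφg
  -- `c ≤ k`: compare `φ (ζ s)` computed in two ways
  have hck : c ≤ k := by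
    -- the identity along `s ↦ ζ s`
    have hcont : Continuous fun s : ℂ ↦ ζ * s := continuous_const.mul continuous_id
    have hζ0 : (fun s : ℂ ↦ ζ * s) 0 = 0 := by simp
    have hφgζ : ∀ᶠ s in 𝓝 (0 : ℂ), φ (ζ * s) = (ζ * s) ^ k * g (ζ * s) := by
      have := hcont.continuousAt.tendsto.eventually (hζ0 ▸ hφg :)
      exact this
    -- `G s = ζ^k g(ζ s) - ζ^c g(s)` vanishes for `s ≠ 0` near `0`
    set G : ℂ → ℂ := fun s ↦ ζ ^ k * g (ζ * s) - ζ ^ c * g s with hGdef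
    have hGev : ∀ᶠ s in 𝓝 (0 : ℂ), G s * s ^ k = 0 := by
      filter_upwards [heig, hφg, hφgζ] with s h1 h2 h3
      simp only [hGdef]
      have : ζ ^ k * g (ζ * s) * s ^ k = ζ ^ c * g s * s ^ k := by
        calc ζ ^ k * g (ζ * s) * s ^ k = (ζ * s) ^ k * g (ζ * s) := by ring
          _ = φ (ζ * s) := h3.symm
          _ = ζ ^ c * φ s := h1
          _ = ζ ^ c * g s * s ^ k := by rw [h2]; ring
      linear_combination this
    have hG0 : ∀ᶠ s in 𝓝[≠] (0 : ℂ), G s = 0 := by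
      have h' : ∀ᶠ s in 𝓝[≠] (0 : ℂ), G s * s ^ k = 0 ∧ s ≠ 0 :=
        (hGev.filter_mono nhdsWithin_le_nhds).and self_mem_nhdsWithin
      filter_upwards [h'] with s hs
      exact (mul_eq_zero.1 hs.1).resolve_right (pow_ne_zero _ hs.2)
    have hGc : ContinuousAt G 0 := by
      have hgc : ContinuousAt g 0 := hg.continuousAt
      have hgζ : ContinuousAt (fun s ↦ g (ζ * s)) 0 :=
        ContinuousAt.comp (by simpa using hgc) hcont.continuousAt
      exact (continuousAt_const.mul hgζ).sub (continuousAt_const.mul hgc)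
    have hGzero := apply_zero_eq_zero_of_eventuallyEq_punctured hGc hG0
    simp only [hGdef, mul_zero, sub_eq_zero] at hGzero
    have hpow : ζ ^ k = ζ ^ c := mul_right_cancel₀ hg0 hGzero
    -- `k % m = c`
    have hkmod : ζ ^ (k % m) = ζ ^ c := by
      rw [← hpow]
      conv_rhs => rw [← Nat.mod_add_div k m, pow_add, pow_mul, hζ.pow_eq_one, one_pow, mul_one]
    have := hζ.pow_inj (Nat.mod_lt _ (Nat.pos_of_ne_zero hm)) hcm hkmod
    have hle := Nat.mod_le k m
    omega
  -- `φ = s^c · (s^(k-c) g)` near `0`, the second factor being bounded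
  have hbdd : (fun s : ℂ ↦ s ^ (k - c) * g s) =O[𝓝 0] fun _ ↦ (1 : ℂ) := by
    have hc' : ContinuousAt (fun s : ℂ ↦ s ^ (k - c) * g s) 0 :=
      (continuous_pow _).continuousAt.mul hg.continuousAt
    exact hc'.norm.isBoundedUnder_le.isBigO_one ℂ
  have hprod := (isBigO_refl (fun s : ℂ ↦ s ^ c) (𝓝 0)).mul hbdd
  simp only [mul_one] at hprod
  refine hprod.congr' ?_ EventuallyEq.rfl
  filter_upwards [hφg] with s hs
  rw [hs, ← mul_assoc, ← pow_add, Nat.add_sub_cancel' hck]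

/-! ### Entire functions tending to zero at infinity -/

/-- **An entire function which tends to `0` at infinity vanishes identically** (it is bounded,
hence constant by Liouville's theorem, and the constant is the limit `0`).
[cite: Rudin1987, Thm. 10.23] -/
theorem eq_zero_of_differentiable_of_tendsto_cocompact {f : ℂ → ℂ} (hf : Differentiable ℂ f)
    (h0 : Tendsto f (cocompact ℂ) (𝓝 0)) : f = 0 := by
  -- boundedness of the range
  have hb : Bornology.IsBounded (range f) := by
    have h1 : ∀ᶠ z in cocompact ℂ, ‖f z‖ < 1 := by
      have := h0.norm
      rw [norm_zero] at this
      exact this.eventually (gt_mem_nhds one_pos)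
    rw [Filter.Eventually, mem_cocompact] at h1
    obtain ⟨K, hK, hKf⟩ := h1
    obtain ⟨C, hC⟩ := (hK.image hf.continuous).isBounded.subset_closedBall 0
    rw [isBounded_iff_forall_norm_le]
    refine ⟨max C 1, ?_⟩
    rintro _ ⟨z, rfl⟩
    by_cases hz : z ∈ K
    · have := hC ⟨z, hz, rfl⟩
      rw [mem_closedBall, dist_zero_right] at this
      exact this.trans (le_max_left _ _)
    · exact (le_of_lt (hKf hz)).trans (le_max_right _ _)
  -- constant, equal to the limit
  have hconst : ∀ z, f z = f 0 := fun z ↦ hf.apply_eq_apply_of_bounded hb z 0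
  have hlim : Tendsto f (cocompact ℂ) (𝓝 (f 0)) :=
    tendsto_const_nhds.congr fun z ↦ (hconst z).symm
  have h00 : f 0 = 0 := tendsto_nhds_unique hlim h0
  funext z
  rw [hconst z, h00, Pi.zero_apply]

/-! ### Finitely many bounded singularities are removable -/

/-- **Removing finitely many bounded singularities.** If `f` is complex differentiable off a
finite set `T` and bounded on a punctured neighbourhood of each point of `T`, then some ENTIRE
function agrees with `f` off `T` (Riemann's removable singularity theorem at each point of `T`).
[cite: Rudin1987, Thm. 10.20] [cite: Forster1981, §1 Thm. 1.8] -/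
theorem exists_differentiable_eqOn_of_bddAbove {f : ℂ → ℂ} {T : Finset ℂ}
    (hd : DifferentiableOn ℂ f (↑T)ᶜ)
    (hb : ∀ t ∈ T, ∃ U ∈ 𝓝 t, BddAbove (norm ∘ f '' (U \ {t}))) :
    ∃ g : ℂ → ℂ, Differentiable ℂ g ∧ EqOn g f (↑T)ᶜ := by
  classical
  -- update `f` at every point of `T` by its punctured limit
  set g : ℂ → ℂ := fun z ↦ if z ∈ T then limUnder (𝓝[≠] z) f else f z with hgdef
  have hgf : EqOn g f (↑T)ᶜ := fun z hz ↦ by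
    simp only [hgdef, if_neg (show z ∉ T from hz)]
  refine ⟨g, fun z₀ ↦ ?_, hgf⟩
  have hTc : IsClosed (↑T : Set ℂ) := T.finite_toSet.isClosed
  by_cases hz₀ : z₀ ∈ T
  · -- a neighbourhood of `z₀` meeting `T` only at `z₀`, inside the bounded region
    obtain ⟨U, hU, hbU⟩ := hb z₀ hz₀
    have hT' : IsClosed (↑(T.erase z₀) : Set ℂ) := (T.erase z₀).finite_toSet.isClosed
    have hz₀' : z₀ ∈ (↑(T.erase z₀) : Set ℂ)ᶜ := by simp
    set s : Set ℂ := U ∩ (↑(T.erase z₀) : Set ℂ)ᶜ with hsdef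
    have hs : s ∈ 𝓝 z₀ := inter_mem hU (hT'.isOpen_compl.mem_nhds hz₀')
    have hsT : ∀ z ∈ s, z ≠ z₀ → z ∉ T := by
      intro z hz hne hzT
      exact hz.2 (by simp [hne, hzT])
    -- on `s`, `g` is `update f z₀ (limUnder …)`
    have hgs : EqOn g (update f z₀ (limUnder (𝓝[≠] z₀) f)) s := by
      intro z hz
      by_cases hzz : z = z₀
      · subst hzz
        simp [hgdef, hz₀]
      · rw [update_of_ne hzz, hgf (hsT z hz hzz)]
    have hds : DifferentiableOn ℂ f (s \ {z₀}) := hd.mono fun z hz ↦ hsT z hz.1 hz.2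
    have hbs : BddAbove (norm ∘ f '' (s \ {z₀})) :=
      hbU.mono (image_mono fun z (hz : z ∈ s \ {z₀}) ↦ (⟨hz.1.1, hz.2⟩ : z ∈ U \ {z₀}))
    have key := Complex.differentiableOn_update_limUnder_of_bddAbove hs hds hbs
    have hga : DifferentiableOn ℂ g s := key.congr hgs
    exact hga.differentiableAt hs
  · have hnhds : (↑T : Set ℂ)ᶜ ∈ 𝓝 z₀ := hTc.isOpen_compl.mem_nhds hz₀
    exact ((hd.differentiableAt hnhds).congr_of_eventuallyEq
      (eventuallyEq_of_mem hnhds hgf))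

/-! ### A holomorphic `m`-th root -/

/-- **A holomorphic branch of `(A sᵐ + B)^{1/m}` at `0`.** For `m ≠ 0` and `c₀ᵐ = B ≠ 0` the
function `c(s) = c₀ · (1 + A sᵐ / B)^{1/m}` (principal branch) is analytic at `0`, `c(0) = c₀`,
`c(s)ᵐ = A sᵐ + B` for every `s`, and `c(u s) = c(s)` whenever `uᵐ = 1`. [folklore] -/
theorem exists_analyticAt_pow_eq {m : ℕ} (hm : m ≠ 0) (A : ℂ) {B c₀ : ℂ} (hB : B ≠ 0)
    (hc₀ : c₀ ^ m = B) :
    ∃ c : ℂ → ℂ, AnalyticAt ℂ c 0 ∧ c 0 = c₀ ∧ (∀ s, c s ^ m = A * s ^ m + B) ∧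
      ∀ (u s : ℂ), u ^ m = 1 → c (u * s) = c s := by
  set c : ℂ → ℂ := fun s ↦ c₀ * (1 + A * s ^ m / B) ^ ((m : ℂ)⁻¹) with hcdef
  refine ⟨c, ?_, ?_, ?_, ?_⟩
  · have h1 : AnalyticAt ℂ (fun s : ℂ ↦ 1 + A * s ^ m / B) 0 :=
      analyticAt_const.add ((analyticAt_const.mul (analyticAt_id.pow m)).div analyticAt_const hB)
    have hslit : (fun s : ℂ ↦ 1 + A * s ^ m / B) 0 ∈ slitPlane := by
      simp [hm, Complex.one_mem_slitPlane]
    exact analyticAt_const.mul (h1.cpow analyticAt_const hslit)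
  · simp [hcdef, hm]
  · intro s
    simp only [hcdef, mul_pow, Complex.cpow_nat_inv_pow _ hm, hc₀]
    field_simp
    ring
  · intro u s hu
    simp only [hcdef, mul_pow, hu, one_mul]

end Literature.Analysis.Complex

end
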